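import Summits.ABC.ABC.Theses.RibetTakahashiSplit
import Literature.NumberTheory.DiophantineGeometry.ConductorRadicalProofs

/-!
# `ManyPrimeValuationProduct` from a per-covering-set bound: the covering glue, and Jensen's
# inequality for `log` in set-integral form

Helpers (`--supports stmt-ABC-1561`) of the line `jl-zero-cycle-height` (second lead) for the crux
`Summit.ABC.ABC.Theses.RibetTakahashiSplit.ManyPrimeValuationProduct`
(`T(E) := ∏_{p ∥ N} ord_p(Δ_min) ≤ C_ε N^ε` for `E/ℚ` semistable away from `2` with `≥ 4` odd
multiplicative primes). Every Jacquet–Langlands / Ribet–Takahashi approach (Pasten,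
arXiv:1705.09251, Thm 6.1(b)) bounds the PARTIAL products `T_D := ∏_{p ∈ D} ord_p(Δ_min)` over
ADMISSIBLE sets `D` of multiplicative primes: `#D` even (so that the quaternion algebra of
discriminant `∏ D` is indefinite) and the co-level `N / ∏ D` divisible by two multiplicative primes
(Pasten's (b.1)/(b.2), his Lemma 6.16). This file proves, in the crux's own vocabulary
(`WeierstrassCurve.conductorNorm`, `minimalDiscriminantNorm`, `Nat.primeFactors`,
`Nat.factorization`; the skeleton's `multPrimes W = (N).primeFactors.filter (¬ ·² ∣ N)`,
`valProd W D = ∏_{p ∈ D} (Δ_min).factorization p`, `IsCoveringSet` unfolded):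

* `one_le_factorization_of_mem_filter` — every factor of `T` is `≥ 1` (a prime of the conductor
  divides the minimal discriminant: `radical_conductorNorm_eq_holds`);
* `prod_factorization_le_mul` — `T_S ≤ T_A · T_B` for `A ⊆ S`, `S ∖ A ⊆ B ⊆` multiplicative primes;
* `exists_three_coveringSets` — with `≥ 4` multiplicative primes there are three admissible sets
  `D₁, D₂, D₃` (even, `#Dᵢ ≥ 2`, complement `≥ 2`) with `T ≤ T_{D₁} T_{D₂} T_{D₃}`;
* `manyPrimeValuationProduct_of_pairedFactorisationBound` — the registered sub-goal: a bound
  `T_D ≤ C_ε N^ε` over admissible `D` implies the crux (`(max C 1)³ N^ε` at `ε/3`);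
* `jensen_log` — `mean_F log u ≤ log mean_F u` on a set of finite positive measure (the step that
  turns the package inequality of the line into a statement about `mean_F log ‖s‖²_pt`).
-/

noncomputable section

-- `Summit.<Summit>.<Problem>`: for the single-conjunct summit `ABC` the duplicate `ABC.ABC` is mandated.
set_option linter.dupNamespace false

namespace Summit.ABC.ABC.Theorems.ManyPrimeValuationProduct

open MeasureTheory Finset

/-! ## Every factor of `T` is at least one -/

/-- A multiplicative prime `p` of `W` (`p ∣ N`, `p² ∤ N`) divides the minimal discriminant, so
`ord_p(Δ_min) ≥ 1` (`rad N = rad Δ_min`, `radical_conductorNorm_eq_holds`). [folklore] -/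
theorem one_le_factorization_of_mem_filter (W : WeierstrassCurve ℚ) [W.IsElliptic] {p : ℕ}
    (hp : p ∈ (W.conductorNorm ℤ).primeFactors.filter (fun p => ¬ p ^ 2 ∣ W.conductorNorm ℤ)) :
    1 ≤ (W.minimalDiscriminantNorm ℤ).factorization p := by
  have hrad : UniqueFactorizationMonoid.radical (W.conductorNorm ℤ) =
      UniqueFactorizationMonoid.radical (W.minimalDiscriminantNorm ℤ) :=
    W.radical_conductorNorm_eq_holds
  have hpf : (W.conductorNorm ℤ).primeFactors = (W.minimalDiscriminantNorm ℤ).primeFactors := by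
    rw [← Nat.primeFactors_radical, hrad, Nat.primeFactors_radical]
  have hp1 : p ∈ (W.conductorNorm ℤ).primeFactors := (Finset.mem_filter.mp hp).1
  rw [hpf] at hp1
  obtain ⟨hpp, hpd, hne⟩ := Nat.mem_primeFactors.mp hp1
  exact hpp.factorization_pos_of_dvd hne hpd

/-- Splitting a valuation product along `A ⊆ S` with `S ∖ A ⊆ B ⊆` multiplicative primes:
`T_S ≤ T_A · T_B` (all factors over multiplicative primes are `≥ 1`). [folklore] -/
theorem prod_factorization_le_mul (W : WeierstrassCurve ℚ) [W.IsElliptic] {S A B : Finset ℕ}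
    (hA : A ⊆ S) (hSB : S \ A ⊆ B)
    (hB : B ⊆ (W.conductorNorm ℤ).primeFactors.filter (fun p => ¬ p ^ 2 ∣ W.conductorNorm ℤ)) :
    ∏ p ∈ S, (W.minimalDiscriminantNorm ℤ).factorization p ≤
      (∏ p ∈ A, (W.minimalDiscriminantNorm ℤ).factorization p) *
        ∏ p ∈ B, (W.minimalDiscriminantNorm ℤ).factorization p := by
  classical
  rw [← Finset.prod_sdiff hA, mul_comm]
  refine Nat.mul_le_mul_left _ ?_
  exact Finset.prod_le_prod_of_subset_of_one_le' hSB
    (fun p hp _ => one_le_factorization_of_mem_filter W (hB hp))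

/-! ## Three admissible (covering) sets -/

/-- **Three covering sets.** If `W` has `≥ 4` multiplicative primes `S`, there are
`D₁, D₂, D₃ ⊆ S`, each of even cardinality `≥ 2` with `#(S ∖ Dᵢ) ≥ 2`, such that
`T_S ≤ T_{D₁} T_{D₂} T_{D₃}`: for `#S` even take `S ∖ {a,b}`, `{a,b}`, `{a,b}`; for `#S` odd take
`S ∖ {a,b,c}`, `{a,b}`, `{a,c}`. [folklore] -/
theorem exists_three_coveringSets (W : WeierstrassCurve ℚ) [W.IsElliptic]
    (h4 : 4 ≤ ((W.conductorNorm ℤ).primeFactors.filter (fun p => ¬ p ^ 2 ∣ W.conductorNorm ℤ)).card) :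
    ∃ D₁ D₂ D₃ : Finset ℕ,
      (D₁ ⊆ (W.conductorNorm ℤ).primeFactors.filter (fun p => ¬ p ^ 2 ∣ W.conductorNorm ℤ) ∧
        Even D₁.card ∧ 2 ≤ D₁.card ∧
        2 ≤ ((W.conductorNorm ℤ).primeFactors.filter (fun p => ¬ p ^ 2 ∣ W.conductorNorm ℤ) \ D₁).card) ∧
      (D₂ ⊆ (W.conductorNorm ℤ).primeFactors.filter (fun p => ¬ p ^ 2 ∣ W.conductorNorm ℤ) ∧
        Even D₂.card ∧ 2 ≤ D₂.card ∧
        2 ≤ ((W.conductorNorm ℤ).primeFactors.filter (fun p => ¬ p ^ 2 ∣ W.conductorNorm ℤ) \ D₂).card) ∧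
      (D₃ ⊆ (W.conductorNorm ℤ).primeFactors.filter (fun p => ¬ p ^ 2 ∣ W.conductorNorm ℤ) ∧
        Even D₃.card ∧ 2 ≤ D₃.card ∧
        2 ≤ ((W.conductorNorm ℤ).primeFactors.filter (fun p => ¬ p ^ 2 ∣ W.conductorNorm ℤ) \ D₃).card) ∧
      ∏ p ∈ (W.conductorNorm ℤ).primeFactors.filter (fun p => ¬ p ^ 2 ∣ W.conductorNorm ℤ),
          (W.minimalDiscriminantNorm ℤ).factorization p ≤
        (∏ p ∈ D₁, (W.minimalDiscriminantNorm ℤ).factorization p) *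
          (∏ p ∈ D₂, (W.minimalDiscriminantNorm ℤ).factorization p) *
            ∏ p ∈ D₃, (W.minimalDiscriminantNorm ℤ).factorization p := by
  classical
  set S := (W.conductorNorm ℤ).primeFactors.filter (fun p => ¬ p ^ 2 ∣ W.conductorNorm ℤ) with hS
  -- three distinct multiplicative primes
  obtain ⟨a, ha⟩ : S.Nonempty := Finset.card_pos.mp (by omega)
  obtain ⟨b, hb⟩ : (S.erase a).Nonempty :=
    Finset.card_pos.mp (by rw [Finset.card_erase_of_mem ha]; omega)
  obtain ⟨c, hc⟩ : ((S.erase a).erase b).Nonempty :=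
    Finset.card_pos.mp (by rw [Finset.card_erase_of_mem hb, Finset.card_erase_of_mem ha]; omega)
  have hba : b ≠ a := (Finset.mem_erase.mp hb).1
  have hbS : b ∈ S := (Finset.mem_erase.mp hb).2
  have hcb : c ≠ b := (Finset.mem_erase.mp hc).1
  have hc' : c ∈ S.erase a := (Finset.mem_erase.mp hc).2
  have hca : c ≠ a := (Finset.mem_erase.mp hc').1
  have hab : a ≠ b := hba.symm
  have hpab : ({a, b} : Finset ℕ) ⊆ S := by
    intro x hx; rcases Finset.mem_insert.mp hx with rfl | hx
    · exact ha
    · rwa [Finset.mem_singleton.mp hx]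
  have hpac : ({a, c} : Finset ℕ) ⊆ S := by
    intro x hx; rcases Finset.mem_insert.mp hx with rfl | hx
    · exact ha
    · rw [Finset.mem_singleton.mp hx]; exact (Finset.mem_erase.mp hc').2
  have hcab : ({a, b} : Finset ℕ).card = 2 := Finset.card_pair hab
  have hcac : ({a, c} : Finset ℕ).card = 2 := Finset.card_pair hca.symm
  have covPair : ∀ {x y : ℕ}, x ≠ y → ({x, y} : Finset ℕ) ⊆ S →
      (({x, y} : Finset ℕ) ⊆ S ∧ Even ({x, y} : Finset ℕ).card ∧ 2 ≤ ({x, y} : Finset ℕ).card ∧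
        2 ≤ (S \ {x, y}).card) := by
    intro x y hxy hsub
    refine ⟨hsub, ?_, ?_, ?_⟩
    · rw [Finset.card_pair hxy]; exact even_two
    · rw [Finset.card_pair hxy]
    · rw [Finset.card_sdiff_of_subset hsub, Finset.card_pair hxy]; omega
  have hD₂ := covPair hab hpab
  have hD₃ := covPair hca.symm hpac
  have one_le : ∀ {X : Finset ℕ}, X ⊆ S → 1 ≤ ∏ p ∈ X, (W.minimalDiscriminantNorm ℤ).factorization p :=
    fun hX => Finset.one_le_prod' fun p hp => one_le_factorization_of_mem_filter W (hX hp)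
  rcases Nat.even_or_odd S.card with heven | hodd
  · -- even: D₁ = S ∖ {a,b}, D₂ = D₃ = {a,b}
    refine ⟨S \ {a, b}, {a, b}, {a, b}, ⟨Finset.sdiff_subset, ?_, ?_, ?_⟩, hD₂, hD₂, ?_⟩
    · rw [Finset.card_sdiff_of_subset hpab, hcab]
      exact (Nat.even_sub (by omega)).mpr (by simp [heven])
    · rw [Finset.card_sdiff_of_subset hpab, hcab]; omega
    · rw [Finset.sdiff_sdiff_eq_self hpab, hcab]
    · have h1 := prod_factorization_le_mul W Finset.sdiff_subset
        (by rw [Finset.sdiff_sdiff_eq_self hpab]) hpab (S := S) (A := S \ {a, b}) (B := {a, b})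
      calc ∏ p ∈ S, (W.minimalDiscriminantNorm ℤ).factorization p
          ≤ (∏ p ∈ S \ {a, b}, (W.minimalDiscriminantNorm ℤ).factorization p) *
              ∏ p ∈ ({a, b} : Finset ℕ), (W.minimalDiscriminantNorm ℤ).factorization p := h1
        _ ≤ (∏ p ∈ S \ {a, b}, (W.minimalDiscriminantNorm ℤ).factorization p) *
              (∏ p ∈ ({a, b} : Finset ℕ), (W.minimalDiscriminantNorm ℤ).factorization p) *
              ∏ p ∈ ({a, b} : Finset ℕ), (W.minimalDiscriminantNorm ℤ).factorization p :=
            Nat.le_mul_of_pos_right _ (one_le hpab)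
  · -- odd: D₁ = S ∖ {a,b,c}, D₂ = {a,b}, D₃ = {a,c}
    have hpabc : ({a, b, c} : Finset ℕ) ⊆ S := by
      intro x hx
      rcases Finset.mem_insert.mp hx with rfl | hx
      · exact ha
      rcases Finset.mem_insert.mp hx with rfl | hx
      · exact hbS
      · rw [Finset.mem_singleton.mp hx]; exact (Finset.mem_erase.mp hc').2
    have hcabc : ({a, b, c} : Finset ℕ).card = 3 :=
      Finset.card_eq_three.mpr ⟨a, b, c, hab, hca.symm, hcb.symm, rfl⟩
    have h5 : 5 ≤ S.card := by rcases hodd with ⟨k, hk⟩; omega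
    refine ⟨S \ {a, b, c}, {a, b}, {a, c}, ⟨Finset.sdiff_subset, ?_, ?_, ?_⟩, hD₂, hD₃, ?_⟩
    · rw [Finset.card_sdiff_of_subset hpabc, hcabc]
      refine (Nat.even_sub (by omega)).mpr ⟨fun h => ?_, fun h => ?_⟩
      · exact absurd h (Nat.not_even_iff_odd.mpr hodd)
      · exact absurd h (by decide)
    · rw [Finset.card_sdiff_of_subset hpabc, hcabc]; omega
    · rw [Finset.sdiff_sdiff_eq_self hpabc, hcabc]; omega
    · have h1 := prod_factorization_le_mul W Finset.sdiff_subset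
        (by rw [Finset.sdiff_sdiff_eq_self hpabc]) hpabc (S := S) (A := S \ {a, b, c}) (B := {a, b, c})
      have hsub2 : ({a, b} : Finset ℕ) ⊆ {a, b, c} := by
        intro x hx
        rcases Finset.mem_insert.mp hx with rfl | hx
        · exact Finset.mem_insert_self _ _
        · rw [Finset.mem_singleton.mp hx]
          exact Finset.mem_insert_of_mem (Finset.mem_insert_self _ _)
      have hrest : ({a, b, c} : Finset ℕ) \ {a, b} ⊆ {a, c} := by
        intro x hx
        have hx1 := (Finset.mem_sdiff.mp hx).1
        have hx2 := (Finset.mem_sdiff.mp hx).2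
        rcases Finset.mem_insert.mp hx1 with rfl | hx1
        · exact Finset.mem_insert_self _ _
        rcases Finset.mem_insert.mp hx1 with rfl | hx1
        · exact absurd (Finset.mem_insert_of_mem (Finset.mem_singleton_self _)) hx2
        · rw [Finset.mem_singleton.mp hx1]
          exact Finset.mem_insert_of_mem (Finset.mem_singleton_self _)
      have h2 := prod_factorization_le_mul W hsub2 hrest hpac
      calc ∏ p ∈ S, (W.minimalDiscriminantNorm ℤ).factorization p
          ≤ (∏ p ∈ S \ {a, b, c}, (W.minimalDiscriminantNorm ℤ).factorization p) *
              ∏ p ∈ ({a, b, c} : Finset ℕ), (W.minimalDiscriminantNorm ℤ).factorization p := h1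
        _ ≤ (∏ p ∈ S \ {a, b, c}, (W.minimalDiscriminantNorm ℤ).factorization p) *
              ((∏ p ∈ ({a, b} : Finset ℕ), (W.minimalDiscriminantNorm ℤ).factorization p) *
                ∏ p ∈ ({a, c} : Finset ℕ), (W.minimalDiscriminantNorm ℤ).factorization p) :=
            Nat.mul_le_mul_left _ h2
        _ = _ := by ring

/-! ## The covering glue: a per-covering-set bound implies the crux -/

/-- **The covering glue** (registered sub-goal of stmt-ABC-1561, line `jl-zero-cycle-height`): if for
every `ε > 0` there is `C` with `T_D ≤ C N^ε` for every curve semistable away from `2` and every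
ADMISSIBLE set `D` of multiplicative primes (`#D` even, `≥ 2`, at least two multiplicative primes
outside `D`), then `ManyPrimeValuationProduct` holds: with `≥ 4` odd multiplicative primes the set of
all multiplicative primes is covered by three admissible sets (`exists_three_coveringSets`), every
factor is `≥ 1`, and `T ≤ T_{D₁}T_{D₂}T_{D₃} ≤ (max C 1)³ N^ε` at `ε/3`. [folklore] -/
theorem manyPrimeValuationProduct_of_pairedFactorisationBound : (∀ ε : ℝ, 0 < ε → ∃ C : ℝ, ∀ (W : WeierstrassCurve ℚ) [W.IsElliptic], (∀ p : ℕ, p.Prime → p ≠ 2 → ¬ p ^ 2 ∣ W.conductorNorm ℤ) → ∀ D : Finset ℕ, D ⊆ (W.conductorNorm ℤ).primeFactors.filter (fun p => ¬ p ^ 2 ∣ W.conductorNorm ℤ) → Even D.card → 2 ≤ D.card → 2 ≤ ((W.conductorNorm ℤ).primeFactors.filter (fun p => ¬ p ^ 2 ∣ W.conductorNorm ℤ) \ D).card → ((∏ p ∈ D, (W.minimalDiscriminantNorm ℤ).factorization p : ℕ) : ℝ) ≤ C * (W.conductorNorm ℤ : ℝ) ^ ε) → Summit.ABC.ABC.Theses.RibetTakahashiSplit.ManyPrimeValuationProduct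 := by
  intro hP ε hε
  obtain ⟨C, hC⟩ := hP (ε / 3) (by positivity)
  refine ⟨(max C 1) ^ 3, fun W _ hss h4 => ?_⟩
  set S := (W.conductorNorm ℤ).primeFactors.filter (fun p => ¬ p ^ 2 ∣ W.conductorNorm ℤ) with hS
  have hS4 : 4 ≤ S.card := by
    refine le_trans h4 (Finset.card_le_card fun p hp => ?_)
    simp only [hS, Finset.mem_filter] at hp ⊢
    exact ⟨hp.1, hp.2.2⟩
  obtain ⟨D₁, D₂, D₃, hD₁, hD₂, hD₃, hprod⟩ := exists_three_coveringSets W hS4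
  have hN0' : 0 < W.conductorNorm ℤ := W.conductorNorm_pos_holds
  set N : ℝ := (W.conductorNorm ℤ : ℝ) with hNdef
  have hN0 : 0 < N := by rw [hNdef]; exact_mod_cast hN0'
  have hb : ∀ D, (D ⊆ S ∧ Even D.card ∧ 2 ≤ D.card ∧ 2 ≤ (S \ D).card) →
      ((∏ p ∈ D, (W.minimalDiscriminantNorm ℤ).factorization p : ℕ) : ℝ) ≤ max C 1 * N ^ (ε / 3) :=
    fun D hD => (hC W hss D hD.1 hD.2.1 hD.2.2.1 hD.2.2.2).trans
      (mul_le_mul_of_nonneg_right (le_max_left _ _) (Real.rpow_nonneg hN0.le _))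
  have hpow : (N ^ (ε / 3)) ^ (3 : ℕ) = N ^ ε := by
    rw [← Real.rpow_natCast, ← Real.rpow_mul hN0.le]; norm_num
  change ((∏ p ∈ S, (W.minimalDiscriminantNorm ℤ).factorization p : ℕ) : ℝ) ≤ (max C 1) ^ 3 * N ^ ε
  calc ((∏ p ∈ S, (W.minimalDiscriminantNorm ℤ).factorization p : ℕ) : ℝ)
        ≤ ((∏ p ∈ D₁, (W.minimalDiscriminantNorm ℤ).factorization p : ℕ) : ℝ) *
            ((∏ p ∈ D₂, (W.minimalDiscriminantNorm ℤ).factorization p : ℕ) : ℝ) *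
            ((∏ p ∈ D₃, (W.minimalDiscriminantNorm ℤ).factorization p : ℕ) : ℝ) := by
        exact_mod_cast hprod
    _ ≤ (max C 1 * N ^ (ε / 3)) * (max C 1 * N ^ (ε / 3)) * (max C 1 * N ^ (ε / 3)) := by
        gcongr
        · exact hb D₁ hD₁
        · exact hb D₂ hD₂
        · exact hb D₃ hD₃
    _ = (max C 1) ^ 3 * (N ^ (ε / 3)) ^ (3 : ℕ) := by ring
    _ = (max C 1) ^ 3 * N ^ ε := by rw [hpow]

/-! ## Jensen's inequality for `log` on a set of finite positive measure -/

/-- **Jensen for the logarithm**, set-integral form: for `u` and `log u` integrable on `F`,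
`0 < μ F < ∞`, `u > 0` a.e. on `F` and `∫_F u > 0`,
`(μ F)⁻¹ ∫_F log u ≤ log ((μ F)⁻¹ ∫_F u)`. Proof: `log u ≤ log m + u/m − 1` pointwise with `m` the
mean, then integrate. [folklore] -/
theorem jensen_log {α : Type*} [MeasurableSpace α] {μ : Measure α} {F : Set α} {u : α → ℝ}
    (hF0 : μ F ≠ 0) (hFtop : μ F ≠ ⊤) (hu : IntegrableOn u F μ)
    (hlu : IntegrableOn (fun z => Real.log (u z)) F μ)
    (hpos : ∀ᵐ z ∂(μ.restrict F), 0 < u z) (hint : 0 < ∫ z in F, u z ∂μ) :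
    (μ F).toReal⁻¹ * ∫ z in F, Real.log (u z) ∂μ ≤
      Real.log ((μ F).toReal⁻¹ * ∫ z in F, u z ∂μ) := by
  set V : ℝ := (μ F).toReal with hV
  set I : ℝ := ∫ z in F, u z ∂μ with hI
  have hVpos : 0 < V := ENNReal.toReal_pos hF0 hFtop
  set m : ℝ := V⁻¹ * I with hm
  have hmpos : 0 < m := mul_pos (inv_pos.mpr hVpos) hint
  haveI : IsFiniteMeasure (μ.restrict F) := ⟨by rwa [Measure.restrict_apply_univ, lt_top_iff_ne_top]⟩
  have hpt : ∀ᵐ z ∂(μ.restrict F), Real.log (u z) ≤ (Real.log m - 1) + u z / m := by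
    filter_upwards [hpos] with z hz
    have h1 : Real.log (u z / m) ≤ u z / m - 1 := Real.log_le_sub_one_of_pos (div_pos hz hmpos)
    rw [Real.log_div hz.ne' hmpos.ne'] at h1
    linarith
  have hgi : Integrable (fun z => (Real.log m - 1) + u z / m) (μ.restrict F) :=
    (integrable_const _).add (hu.div_const m)
  have hle : ∫ z in F, Real.log (u z) ∂μ ≤ ∫ z in F, ((Real.log m - 1) + u z / m) ∂μ :=
    integral_mono_ae hlu hgi hpt
  have hrhs : ∫ z in F, ((Real.log m - 1) + u z / m) ∂μ = V * Real.log m := by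
    rw [integral_add (integrable_const _) (hu.div_const m), integral_const, integral_div,
      measureReal_restrict_apply_univ, measureReal_def, ← hV, smul_eq_mul, ← hI]
    have hmI : I / m = V := by
      rw [hm]; field_simp [hint.ne', hVpos.ne']
    rw [hmI]; ring
  rw [hrhs] at hle
  calc V⁻¹ * ∫ z in F, Real.log (u z) ∂μ ≤ V⁻¹ * (V * Real.log m) :=
        mul_le_mul_of_nonneg_left hle (inv_nonneg.mpr hVpos.le)
    _ = Real.log m := by rw [← mul_assoc, inv_mul_cancel₀ hVpos.ne', one_mul]

end Summit.ABC.ABC.Theorems.ManyPrimeValuationProduct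

end
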